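import Literature.AlgebraicGeometry.Motives.PoincareUniversal.DualNumberChartPoints
import Literature.AlgebraicGeometry.Morphisms.CechUnitCocycleKodairaSpencerInjective
import HarnessLib

/-!
# Injectivity of the Kodaira–Spencer maps of the Artinian charts of the Poincaré sheaf (M13 node N3, γ8)

Cell hodgecm-mathlib, author B-p07 (g12).  For `𝒫` of rank one on `A₀ × Â`, a finite affine cover `V` of `A₀` and ANY frames `F` of
`𝒫|_{A₀ × Spec 𝒪_{Â,y₀}/𝔪^{n+2}}` on the preimages, the Kodaira–Spencer map of the model cocycle at the augmentation
`ρ : 𝒪_{Â,y₀}/𝔪^{n+2} → ℂ` is INJECTIVE, provided every `ℂ[ε]`-point `w` of `Â` along which `𝒫` restricts to a constant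
first-order deformation is constant (first-order rigidity of `𝒫`, `PoincareUniversal/PoincareFirstOrderRigid`).
Road ([MumfordAV1970] §13, proof of the Theorem, pp. 125–130; [GortzWedhorn2023] Prop. 27.122): `KS(D) = 0` ⟹
(`Morphisms/CechUnitCocycleKodairaSpencerInjective`) `(A₀ ◁ w_0)^*𝒫 ≅ (A₀ ◁ w_D)^*𝒫` on `A₀ × Spec ℂ[ε]` ⟹ the left side is
`pr₁^*(𝒫_{y₀})` ⟹ rigidity: `w_D` constant ⟹ (`ThickeningArtinianPoints.algHom_thickRing_ext` over `ℂ[ε]`) `ρ + εD = ρ`, `D = 0`.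

* `nonempty_iso_pullback_wε_of_ksLinear_eq_zero`, `ksLinear_injective_of_rigid`, `modelTower_ksLinear_injective_of_rigid`
  (the `hKS` input of `PoincareUniversal/ModelTowerInstance.socket_N3_liftModel₂_of_frames_base`, token for token).

HC_CM is proved only modulo the 7 printed citations until rung 0 closes.

## References
* [MumfordAV1970] D. Mumford, *Abelian Varieties* (1970), §13 (proof of the Thm. pp. 125–130).
* [GortzWedhorn2023] U. Görtz, T. Wedhorn, *Algebraic Geometry II* (2023), Prop. 27.122.
-/

noncomputable section

universe u v

open TensorProduct CategoryTheory AlgebraicGeometry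

namespace Literature.AlgebraicGeometry.Motives.AbelianVariety

open CategoryTheory CategoryTheory.Limits AlgebraicGeometry MonoidalCategory CartesianMonoidalCategory IsLocalRing
open Literature.AlgebraicGeometry.AbelianSchemes Literature.AlgebraicGeometry.AbelianVarieties
  Literature.AlgebraicGeometry.Modules Literature.AlgebraicGeometry.Morphisms
  Literature.AlgebraicGeometry.Morphisms.CechUnitCocycle Literature.AlgebraicGeometry.Motives
open scoped DualNumber
open TrivSqZeroExt (fstHom)

section Gamma8

variable (A₀ : AbelianVariety ℂ) {Θ : CartierDivisor A₀.X.left} (hΘ : Θ.IsAmple)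
  (P : (A₀.X ⊗ (A₀.dualOf Θ hΘ).X).left.Modules)
  {ι : Type} (V : ι → A₀.X.left.Opens) (hV : ∀ a, IsAffineOpen (V a))
  (y₀ : (A₀.dualOf Θ hΘ).X.left) [LocallyOfFiniteType (A₀.dualOf Θ hΘ).X.hom]
  (hy₀ : IsClosed ({y₀} : Set (A₀.dualOf Θ hΘ).X.left))
  [IsSeparated A₀.X.hom]


/-- **(γ8c, first half) `KS(D) = 0` ⟹ `(A₀ ◁ w_0)^*𝒫 ≅ (A₀ ◁ w_D)^*𝒫` on `A₀ × Spec ℂ[ε]`**, `w_0 = wε (constLift ρ)`,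
`w_D = wε (derivLift ρ D)`, for transition data `p` of `𝒫|_{A₀ × Spec 𝒪_{Â,y₀}/𝔪^{m+1}}` read in ANY frames `F` on the
preimages of the finite affine cover `V` through the absolute flat model. [cite: MumfordAV1970, §13 (proof of the Thm. pp. 125–130)] -/
theorem nonempty_iso_pullback_wε_of_ksLinear_eq_zero (hcov : iSup V = ⊤) (m : ℕ)
    (F : IFrames (PBn A₀ hΘ P y₀ m) (fun a => (pullback.fst A₀.X.hom (sB A₀ hΘ y₀ m)) ⁻¹ᵁ V a))
    (D : DerAt (ρℂ (A₀.dualOf Θ hΘ).X y₀ hy₀ m))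
    (hD : ksLinear ((absModelData A₀.X (sB A₀ hΘ y₀ m) (thickeningPt_hom_eq (A₀.dualOf Θ hΘ).X y₀ m) V hV).cocycle F)
      (ρℂ (A₀.dualOf Θ hΘ).X y₀ hy₀ m) D = 0) :
    Nonempty ((Scheme.Modules.pullback (A₀.X ◁ wε A₀ hΘ y₀ m (constLift (ρℂ (A₀.dualOf Θ hΘ).X y₀ hy₀ m))).left).obj P ≅
      (Scheme.Modules.pullback (A₀.X ◁ wε A₀ hΘ y₀ m
        (derivLift (ρℂ (A₀.dualOf Θ hΘ).X y₀ hy₀ m) D.1 D.2)).left).obj P) := by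
  have hWε : (⨆ a, pullback.fst A₀.X.hom dualNumberOver.hom ⁻¹ᵁ V a) = ⊤ := by
    rw [← Scheme.Hom.preimage_iSup, hcov, Scheme.Hom.preimage_top]
  obtain ⟨e⟩ := ModelData.nonempty_iso_pullback_of_ksLinear_eq_zero
    (absModelData A₀.X (sB A₀ hΘ y₀ m) (thickeningPt_hom_eq (A₀.dualOf Θ hΘ).X y₀ m) V hV)
    (absModelData A₀.X dualNumberOver.hom dualNumberOver_hom V hV) hWε F (ρℂ (A₀.dualOf Θ hΘ).X y₀ hy₀ m) D
    (g₀ := gε A₀ hΘ y₀ m (constLift (ρℂ (A₀.dualOf Θ hΘ).X y₀ hy₀ m)))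
    (g₁ := gε A₀ hΘ y₀ m (derivLift (ρℂ (A₀.dualOf Θ hΘ).X y₀ hy₀ m) D.1 D.2))
    (absModelData_hom A₀.X _ _ _ _ _ V hV) (absModelData_hom A₀.X _ _ _ _ _ V hV) hD
  exact ⟨(pullbackGεIso A₀ hΘ P y₀ m _).symm ≪≫ e ≪≫ pullbackGεIso A₀ hΘ P y₀ m _⟩

/-- **(γ8d) INJECTIVITY OF THE KODAIRA–SPENCER MAP OF THE ARTINIAN CHART from first-order rigidity of `𝒫` on the
`Â` side.**  For `𝒫` of rank one on `A₀ × Â`, a finite affine cover `V` of `A₀` and ANY frames `F` of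
`𝒫|_{A₀ × Spec 𝒪_{Â,y₀}/𝔪^{n+2}}` on the preimages, the Kodaira–Spencer map of the model cocycle at the augmentation
`ρ : 𝒪_{Â,y₀}/𝔪^{n+2} → ℂ` is injective, PROVIDED every `ℂ[ε]`-point `w` of `Â` with `(A₀ ◁ w)^*𝒫 ≅ pr₁^*N` for a
rank-one `N` on `A₀` is constant (N3d: r1 + core + `(1 × φ_Θ)^*𝒫 ≅ Λ(𝒪(Θ))`).
[cite: MumfordAV1970, §13 (proof of the Thm. pp. 125–130)] [cite: GortzWedhorn2023, Prop. 27.122] -/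
theorem ksLinear_injective_of_rigid (hcov : iSup V = ⊤) (hP1 : HasRank P 1)
    (hrig : ∀ (w : dualNumberOver ⟶ (A₀.dualOf Θ hΘ).X) (N : A₀.X.left.Modules), HasRank N 1 →
      Nonempty ((Scheme.Modules.pullback (A₀.X ◁ w).left).obj P ≅
        (Scheme.Modules.pullback (CartesianMonoidalCategory.fst A₀.X dualNumberOver).left).obj N) →
      ∃ y : 𝟙_ (SchemeOver ℂ) ⟶ (A₀.dualOf Θ hΘ).X, w = toUnit _ ≫ y)
    (n : ℕ) (F : IFrames (PBn A₀ hΘ P y₀ (n + 1)) (fun a => (pullback.fst A₀.X.hom (sB A₀ hΘ y₀ (n + 1))) ⁻¹ᵁ V a)) :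
    Function.Injective (ksLinear
      ((absModelData A₀.X (sB A₀ hΘ y₀ (n + 1)) (thickeningPt_hom_eq (A₀.dualOf Θ hΘ).X y₀ (n + 1)) V hV).cocycle F)
      (ρℂ (A₀.dualOf Θ hΘ).X y₀ hy₀ (n + 1))) := by
  set ev := ρℂ (A₀.dualOf Θ hΘ).X y₀ hy₀ (n + 1) with hev
  refine (injective_iff_map_eq_zero _).2 fun D hD => ?_
  -- (γ8c) `(A₀ ◁ w_0)^*𝒫 ≅ (A₀ ◁ w_D)^*𝒫`, and the left side is the constant deformation `pr₁^*(𝒫_{y₀})`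
  obtain ⟨e⟩ := nonempty_iso_pullback_wε_of_ksLinear_eq_zero A₀ hΘ P V hV y₀ hy₀ hcov (n + 1) F D hD
  have e₀ : (Scheme.Modules.pullback (A₀.X ◁ wε A₀ hΘ y₀ (n + 1) (constLift ev)).left).obj P ≅
      (Scheme.Modules.pullback (CartesianMonoidalCategory.fst A₀.X dualNumberOver).left).obj
        (sliceMod A₀ hΘ P (y₀pt A₀ hΘ y₀ hy₀ (n + 1))) :=
    eqToIso (congrArg (fun k => (Scheme.Modules.pullback (A₀.X ◁ k).left).obj P)
      (wε_constLift A₀ hΘ y₀ hy₀ (n + 1))) ≪≫ pullbackConstIso A₀ hΘ P dualNumberOver _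
  -- rigidity: `w_D` is constant
  obtain ⟨y, hy⟩ := hrig (wε A₀ hΘ y₀ (n + 1) (derivLift ev D.1 D.2)) _
    (hasRank_sliceMod A₀ hΘ P hP1 (y₀pt A₀ hΘ y₀ hy₀ (n + 1))) ⟨e.symm ≪≫ e₀⟩
  -- the constant `ℂ`-point `y` hits `y₀`, hence is `y₀pt`
  have hpt : (Spec.map (CommRingCat.ofHom (derivLift ev D.1 D.2).toRingHom) ≫
      (thickeningPtι (A₀.dualOf Θ hΘ).X y₀ (n + 1)).left) (closedPoint ℂ[ε]) = y₀ :=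
    Spec_map_comp_thickeningPtι_closedPoint (A₀.dualOf Θ hΘ).X (topPt (A₀.dualOf Θ hΘ).X y₀) (n + 1) _
  have hyc : y.left (closedPoint ℂ) = y₀ := by
    have h1 : (wε A₀ hΘ y₀ (n + 1) (derivLift ev D.1 D.2)).left (closedPoint ℂ[ε]) = y₀ := hpt
    rw [hy, Over.comp_left, Scheme.Hom.comp_apply] at h1
    rwa [Subsingleton.elim (closedPoint ℂ) ((toUnit dualNumberOver).left (closedPoint ℂ[ε]))]
  have hyleft := left_eq_y₀pt_left A₀ hΘ y₀ hy₀ (n + 1) y hyc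
  -- hence the two chart points `ev + εD`, `ev` have the same `ℂ[ε]`-point of `Â`, so they are equal (α7′)
  have hleft : Spec.map (CommRingCat.ofHom (derivLift ev D.1 D.2).toRingHom) ≫
      (thickeningPtι (A₀.dualOf Θ hΘ).X y₀ (n + 1)).left =
      Spec.map (CommRingCat.ofHom (constLift ev).toRingHom) ≫ (thickeningPtι (A₀.dualOf Θ hΘ).X y₀ (n + 1)).left := by
    rw [← wε_left, ← wε_left, hy, wε_constLift, Over.comp_left, Over.comp_left, hyleft]
  have heq : derivLift ev D.1 D.2 = constLift ev :=
    algHom_thickRing_ext (A₀.dualOf Θ hΘ).X (topPt (A₀.dualOf Θ hΘ).X y₀) (n + 1)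
      (maximalIdeal_dualNumber_pow_eq_bot n) _ _ hleft
  -- `D = 0`
  apply Subtype.ext
  apply LinearMap.ext
  intro b
  have hb := congrArg (fun φ : Rt (A₀.dualOf Θ hΘ).X y₀ (n + 1) →ₐ[ℂ] ℂ[ε] => (φ b).snd) heq
  simp only [derivLift_apply, constLift_apply, TrivSqZeroExt.snd_add, TrivSqZeroExt.snd_inl,
    TrivSqZeroExt.snd_inr, zero_add] at hb
  simpa using hb

end Gamma8

/-! ### (γ8) THE `hKS` BINDER OF `socket_N3_liftModel₂_of_inputs` / `_of_frames_base`, from first-order rigidity -/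

section Gamma8Tower

variable (A₀ : AbelianVariety ℂ) {Θ : CartierDivisor A₀.X.left} (hΘ : Θ.IsAmple)
  (P : (A₀.X ⊗ (A₀.dualOf Θ hΘ).X).left.Modules)
  (T' : SchemeOver ℂ) (ℒ : (AbelianSchemeOver.ofAbelianVariety A₀).RigidifiedLineBundle T'.hom)
  (t : T'.left) [LocallyOfFiniteType T'.hom] [IsLocallyNoetherian T'.left] (ht : IsClosed ({t} : Set T'.left))
  {ι : Type} (V : ι → A₀.X.left.Opens) (hV : ∀ a, IsAffineOpen (V a))
  (y₀ : (A₀.dualOf Θ hΘ).X.left) [LocallyOfFiniteType (A₀.dualOf Θ hΘ).X.hom]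
  [IsLocallyNoetherian (A₀.dualOf Θ hΘ).X.left] (hy₀ : IsClosed ({y₀} : Set (A₀.dualOf Θ hΘ).X.left))
  [IsSeparated A₀.X.hom]


omit [IsLocallyNoetherian (A₀.dualOf Θ hΘ).X.left] in
/-- **(γ8) THE `hKS` INPUT OF THE M13 MODEL TOWER from first-order rigidity of `𝒫` on the `Â` side**: for every level
`n`, the Kodaira–Spencer map `ksLinear ((modelTower … G).p (n + 1)) (ρℂ Â y₀ (n + 1))` is injective.
[cite: MumfordAV1970, §13 (proof of the Thm. pp. 125–130)] [cite: GortzWedhorn2023, Prop. 27.122] -/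
theorem modelTower_ksLinear_injective_of_rigid (hcov : iSup V = ⊤) (G : GammaInputs A₀ hΘ P T' ℒ t ht V y₀ hy₀)
    (hP1 : HasRank P 1)
    (hrig : ∀ (w : dualNumberOver ⟶ (A₀.dualOf Θ hΘ).X) (N : A₀.X.left.Modules), HasRank N 1 →
      Nonempty ((Scheme.Modules.pullback (A₀.X ◁ w).left).obj P ≅
        (Scheme.Modules.pullback (CartesianMonoidalCategory.fst A₀.X dualNumberOver).left).obj N) →
      ∃ y : 𝟙_ (SchemeOver ℂ) ⟶ (A₀.dualOf Θ hΘ).X, w = toUnit _ ≫ y)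
    (n : ℕ) :
    Function.Injective
      (ksLinear ((modelTower A₀ hΘ P T' ℒ t ht V hV y₀ hy₀ hcov G).p (n + 1))
        (ρℂ (A₀.dualOf Θ hΘ).X y₀ hy₀ (n + 1))) :=
  ksLinear_injective_of_rigid A₀ hΘ P V hV y₀ hy₀ hcov hP1 hrig n (G.FP (n + 1))

end Gamma8Tower

end Literature.AlgebraicGeometry.Motives.AbelianVariety

end
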